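import Summits.CriticalPhenomena.PercolationContinuityZ3.Theses.PercExchangeRateTransport
import Summits.CriticalPhenomena.PercolationContinuityZ3.Theorems.SubcritExchangeUniformity.Negative.CutoffGuard

/-!
# `SubcritExchangeUniformity` (K⁻, crux stmt-CriticalPhenomena-16062), negative lane, part 2b:
# the crux silently contains `0 < p_c(t)` on `(0,1)`

A dependency remark (cdisprove, cycle 1; no definitions, nothing asserts a Theses decl):
by THE GUARD `delta_lt_pcurve` (`CutoffGuard`), every admissible `δ(η)` of K⁻ is `< p_c(t)`; applying
K⁻ on the sub-arc `[t/2, (t+1)/2]` with `η = 1` at any `t ∈ (0,1)` gives `0 < δ < p_c(t)`. So the crux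
`SubcritExchangeUniformity` IMPLIES the positivity conjunct `0 < pc t` of the route item
`CriticalCurveRegular`, and a prover of K⁻ must import a positive lower bound for the anisotropic
critical curve on compact sub-arcs of `(0,1)`.
-/

noncomputable section

namespace Summit.CriticalPhenomena.PercolationContinuityZ3.Theorems.SubcritExchangeUniformity.Negative

open MeasureTheory Filter Topology
open Literature.Probability.Percolation Literature.Probability.LatticeModels
open Literature.Probability.Percolation.DCT16

/-- **K⁻ implies positivity of the anisotropic critical curve on `(0,1)`.** The crux
`SubcritExchangeUniformity` silently contains the conjunct `0 < pc t` of the route item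
`CriticalCurveRegular`: at any `t ∈ (0,1)`, apply K⁻ on the sub-arc `[t/2, (t+1)/2]` with
`η = 1` and feed the resulting `δ > 0` to `delta_lt_pcurve`. (A consequence of the crux, recorded
as a dependency remark; it asserts no Theses decl.) [folklore] -/
theorem pcurve_pos_of_subcritExchangeUniformity
    (h : Summit.CriticalPhenomena.PercolationContinuityZ3.Theses.PercExchangeRateTransport.SubcritExchangeUniformity)
    (t : ℝ) (ht : t ∈ Set.Ioo (0 : ℝ) 1) : 0 < pcurve t := by
  obtain ⟨σ, -, hη⟩ := h (t / 2) ((t + 1) / 2) (by linarith [ht.1]) (by linarith [ht.2])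
    (by linarith [ht.2])
  obtain ⟨δ, hδ, m, hm⟩ := hη 1 one_pos
  have hmem : t ∈ Set.Icc (t / 2) ((t + 1) / 2) := ⟨by linarith [ht.1], by linarith [ht.2]⟩
  exact hδ.trans (delta_lt_pcurve (σ := σ t) (η := 1) (δ := δ) (m := m) ht
    fun n hn p hp1 hp2 => hm n hn t hmem p hp1 hp2)
end Summit.CriticalPhenomena.PercolationContinuityZ3.Theorems.SubcritExchangeUniformity.Negative

end
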